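import Literature.NumberTheory.EllipticCurves.EisensteinSeriesNebentypusLevelRaisedLargeWeight
import HarnessLib

/-!
# All constant terms of `F₂ = E_k^{𝟙,χ} - E_k^{𝟙,χ}(M·)` vanish modulo `𝔪` in every weight of
# Billerey–Menares 2016, Thm. 2.2, at every ODD prime `p` (including `p = 3`)

Topic `Literature/NumberTheory/EllipticCurves`; namespace
`Literature.NumberTheory.EllipticCurves.ModularForms`.  THEOREMS ONLY (no definition, no named
fact).

`EisensteinSeriesNebentypusLevelRaisedLargeWeight` proves the vanishing modulo `𝔪` of all the
constant terms of `F₂ = eisensteinLevelRaised N k χ M` (`= E` of Billerey–Menares 2016, proof of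
Thm. 2.2) in the Billerey–Menares weights for `p ≥ 5`
(`exists_tendsto_eisensteinLevelRaised_slash_valuation_lt_one_of_weight`, `…_corner`).  This file
adds the prime `p = 3`, where the weights are `k ∈ {3, 4} = {p, p + 1}`:

* `k = 3 = p`: `B_{3,χ} ∈ 3 ℤ_{(3)}[χ]` is the case `p = 3` of
  `exists_generalizedBernoulli_prime_eq_mul` (any odd `p`);
* `k = 4 = p + 1`, `χ ≠ 𝟙` (`generalizedBernoulli_four_mem_subring_of_ne_one`): in
  `N³ B₄(c/N) = c⁴/N - 2c³ + c²N - N³/30` (`bernoulli_four_eval`) only the constant `-N³/30` is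
  not `3`-integral, and it is killed by `∑_c χ(c) = 0`;
* `k = 4`, `χ = 𝟙` (so `N = 1`; the von Staudt corner `(p - 1) ∣ k` of B–M 2016 at `p = 3`):
  `-(B₄/16)(M⁴ - 1) = (M² - 1)(M² + 1)/480 ∈ 3 ℤ_{(3)}` as soon as `M² ≡ 1 (mod 9)`
  (`exists_bernoulli_four_div_mul_pow_sub_one_eq_mul`),

and assembles (`exists_tendsto_eisensteinLevelRaised_slash_valuation_lt_one_odd`) the statement
for every odd prime `p`, `p ∤ N`, `χ` primitive modulo `N`, `M ∤ Np` prime, `χ(M)M^k ≡ 1 (mod 𝔪)`,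
`k ∈ {p, p + 1} ∪ [3, p - 1]`, with the von Staudt clause "`(p - 1) ∣ k` and `N = 1` ⟹
`M^{p-1} ≡ 1 (mod p²)`" — exactly the hypotheses of Billerey–Menares 2016, Thm. 2.2 as rendered in
`Literature.NumberTheory.EllipticCurves.BillereyMenares2016_thm22_exists_newform_odd`.

## References

* N. Billerey, R. Menares, *On the modularity of reducible mod `l` Galois representations*, Math.
  Res. Lett. 23 (2016), §2, Thm. 2.2 and its proof; Prop. 1.2. [BillereyMenares2016]
* L. C. Washington, *Introduction to Cyclotomic Fields*, GTM 83 (1997), Thm. 5.10, §5.3.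
  [Washington1997]
-/

noncomputable section

open Complex UpperHalfPlane Filter Finset ModularForm CongruenceSubgroup Matrix
  Matrix.SpecialLinearGroup
open scoped Real NNReal MatrixGroups Topology
open Literature.NumberTheory.LFunctions WithZero

namespace Literature.NumberTheory.EllipticCurves.ModularForms

/-! ### `p = 3`: the Bernoulli numbers `B_{4,χ}` and `B₄ (M⁴ - 1)` -/

section Three

/-- `B₄(x) = x⁴ - 2x³ + x² - 1/30`. [folklore] -/
theorem bernoulli_four_eval (x : ℚ) :
    (Polynomial.bernoulli 4).eval x = x ^ 4 - 2 * x ^ 3 + x ^ 2 - 1 / 30 := by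
  rw [Polynomial.bernoulli_def]
  simp only [Finset.sum_range_succ, Finset.sum_range_zero, Polynomial.eval_add,
    Polynomial.eval_monomial, zero_add]
  rw [bernoulli_zero, bernoulli_one, bernoulli_eq_bernoulli'_of_ne_one (by norm_num : (2 : ℕ) ≠ 1),
    bernoulli_eq_bernoulli'_of_ne_one (by norm_num : (3 : ℕ) ≠ 1),
    bernoulli_eq_bernoulli'_of_ne_one (by norm_num : (4 : ℕ) ≠ 1), bernoulli'_two,
    bernoulli'_three, bernoulli'_four]
  norm_num [Nat.choose]
  ring

/-- **`N³ B₄(c/N) = r + N³ B₄` with `r = c⁴/N - 2c³ + c²N` `3`-integral** (`3 ∤ N`).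
[cite: Washington1997, §5.3] -/
theorem exists_genBernoulliCoeff_four_eq {p : ℕ} [Fact p.Prime] (hp3 : p = 3) {N : ℕ}
    (hN : ¬ p ∣ N) (c : ℕ) :
    ∃ r : ℚ, Rat.padicValuation p r ≤ 1 ∧
      genBernoulliCoeff 4 N c = r + (N : ℚ) ^ 3 * bernoulli 4 := by
  subst hp3
  have hvN : Rat.padicValuation 3 (N : ℚ) = 1 := padicValuation_natCast_eq_one hN
  set x : ℚ := (c : ℚ) / N with hx
  have hvx : Rat.padicValuation 3 x ≤ 1 := by
    rw [hx, map_div₀, hvN, div_one]; exact padicValuation_natCast_le_one c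
  refine ⟨(N : ℚ) ^ 3 * (x ^ 4 - 2 * x ^ 3 + x ^ 2), ?_, ?_⟩
  · rw [map_mul, map_pow, hvN, one_pow, one_mul]
    refine (Valuation.map_add _ _ _).trans (max_le ?_ ?_)
    · refine (Valuation.map_sub_le _ ?_ ?_)
      · rw [map_pow]; exact pow_le_one' hvx _
      · rw [map_mul, map_pow]
        exact mul_le_one' (padicValuation_natCast_le_one (p := 3) 2) (pow_le_one' hvx _)
    · rw [map_pow]; exact pow_le_one' hvx _
  · rw [genBernoulliCoeff_of_one_le (by norm_num : 1 ≤ 4), bernoulli_four_eval,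
      bernoulli_eq_bernoulli'_of_ne_one (by norm_num : (4 : ℕ) ≠ 1), bernoulli'_four]
    ring

/-- **`B_{4,χ}` is `3`-integral for `χ ≠ 𝟙`** (`3 ∤ N`): the non-integral part `N³ B₄ ∑_c χ(c)`
vanishes.  (The weight `k = 4 = p + 1` of Billerey–Menares 2016, Thm. 2.2 at `p = 3`.)
[cite: Washington1997, §5.3 (Thm. 5.11, Cor. 5.13)] [cite: BillereyMenares2016, §2, Thm. 2.2] -/
theorem generalizedBernoulli_four_mem_subring_of_ne_one {p : ℕ} [Fact p.Prime] (hp3 : p = 3)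
    {R : Type*} [CommRing R] [IsDomain R] [Algebra ℚ R] {N : ℕ} [NeZero N]
    {χ : DirichletCharacter R N} (hχ1 : χ ≠ 1) (S : Subring R) (hχ : ∀ j, χ j ∈ S)
    (hS : ∀ q : ℚ, Rat.padicValuation p q ≤ 1 → algebraMap ℚ R q ∈ S) (hN : ¬ p ∣ N) :
    generalizedBernoulli 4 χ ∈ S := by
  choose r hr hr' using fun c ↦ exists_genBernoulliCoeff_four_eq hp3 hN c
  have hsum : generalizedBernoulli 4 χ = ∑ j : ZMod N, χ j * algebraMap ℚ R (r j.val) := by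
    rw [generalizedBernoulli_eq_sum]
    have h : ∑ j : ZMod N, χ j * algebraMap ℚ R (genBernoulliCoeff 4 N j.val) =
        ∑ j : ZMod N, χ j * algebraMap ℚ R (r j.val) +
          algebraMap ℚ R ((N : ℚ) ^ 3 * bernoulli 4) * ∑ j : ZMod N, χ j := by
      rw [Finset.mul_sum, ← Finset.sum_add_distrib]
      refine Finset.sum_congr rfl fun j _ ↦ ?_
      rw [hr', map_add]
      ring
    rw [h, MulChar.sum_eq_zero_of_ne_one hχ1, mul_zero, add_zero]
  rw [hsum]
  exact Subring.sum_mem _ fun j _ ↦ Subring.mul_mem _ (hχ j) (hS _ (hr _))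

/-- **The corner `(p, k, χ) = (3, 4, 𝟙)` of Billerey–Menares 2016, Thm. 2.2**: if
`M² ≡ 1 (mod 9)` then `-(B₄/16)(M⁴ - 1) = 3y` with `y` `3`-integral (`B₄ = -1/30` has
`v₃ = -1`, against `v₃(M⁴ - 1) = v₃(M² - 1) ≥ 2`). [cite: BillereyMenares2016, §2, Thm. 2.2]
[cite: Washington1997, Thm. 5.10] -/
theorem exists_bernoulli_four_div_mul_pow_sub_one_eq_mul {p : ℕ} [Fact p.Prime] (hp3 : p = 3)
    {M : ℕ} (hM : M ^ 2 % 9 = 1) :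
    ∃ y : ℚ, Rat.padicValuation p y ≤ 1 ∧
      -(bernoulli 4) / (4 * 4) * ((M : ℚ) ^ 4 - 1) = 3 * y := by
  subst hp3
  have hM1 : 1 ≤ M ^ 2 := by
    by_contra h
    rw [not_le, Nat.lt_one_iff] at h
    rw [h, Nat.zero_mod] at hM
    exact zero_ne_one hM
  have hmod : 1 ≡ M ^ 2 [MOD 9] := by
    rw [Nat.ModEq, Nat.mod_eq_of_lt (by norm_num : 1 < 9), hM]
  obtain ⟨t, ht⟩ := (Nat.modEq_iff_dvd' hM1).mp hmod
  have hcast : ((M : ℚ)) ^ 2 - 1 = 9 * t := by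
    have := congrArg (Nat.cast (R := ℚ)) ht
    push_cast [Nat.cast_sub hM1] at this
    linear_combination this
  refine ⟨(t : ℚ) * ((M : ℚ) ^ 2 + 1) / 160, ?_, ?_⟩
  · rw [map_div₀, map_mul]
    have h160 : Rat.padicValuation 3 (160 : ℚ) = 1 := by
      rw [show (160 : ℚ) = ((160 : ℕ) : ℚ) by norm_num]
      exact padicValuation_natCast_eq_one (by norm_num)
    rw [h160, div_one]
    refine mul_le_one' (padicValuation_natCast_le_one (p := 3) t) ?_
    refine Valuation.map_add_le _ ?_ (by rw [map_one])
    rw [map_pow]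
    exact pow_le_one' (padicValuation_natCast_le_one (p := 3) M) _
  · rw [bernoulli_eq_bernoulli'_of_ne_one (by norm_num : (4 : ℕ) ≠ 1), bernoulli'_four]
    have h4 : ((M : ℚ)) ^ 4 - 1 = (((M : ℚ)) ^ 2 - 1) * (((M : ℚ)) ^ 2 + 1) := by ring
    rw [h4, hcast]
    ring

end Three

/-! ### All constant terms of `F₂` vanish modulo `𝔪`: every odd prime, every B–M weight -/

section Cusps

variable {N : ℕ} [NeZero N] (k : ℕ) (χ : DirichletCharacter ℂ N) (M : ℕ) [NeZero M]
variable {p : ℕ} [Fact p.Prime]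

set_option maxHeartbeats 400000 in
/-- **All constant terms of `F₂ = E_k^{𝟙,χ} - E_k^{𝟙,χ}(M·)` vanish modulo `𝔪` under the
hypotheses of Billerey–Menares 2016, Thm. 2.2, at every odd prime `p`.**  Let `p ≠ 2`, `p ∤ N`,
`χ` primitive modulo `N`, `M` a prime with `M ≠ p`, `gcd(M, N) = 1`, `χ(M) M^k ≡ 1 (mod 𝔪)`,
`k ∈ {p, p + 1} ∪ [3, p - 1]`, and assume the von Staudt clause: if `(p - 1) ∣ k` and `N = 1`
then `M^{p-1} ≡ 1 (mod p²)`.  Then for every `γ ∈ SL₂(ℤ)`, `F₂ ∣_k γ → c_γ` at `i∞` with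
`‖ι⁻¹(c_γ)‖_p < 1` — the step "`λ` divides … hence the reduction `F` of `E` modulo `λ` is
cuspidal" of the printed proof (p. 7), in all its cases: `p ≥ 5`
(`exists_tendsto_eisensteinLevelRaised_slash_valuation_lt_one_of_weight`, `…_corner`) and `p = 3`
(this file). [cite: BillereyMenares2016, §2, Thm. 2.2 (proof, p. 7) and Prop. 1.2]
[cite: Washington1997, Thm. 5.10, §5.3] -/
theorem exists_tendsto_eisensteinLevelRaised_slash_valuation_lt_one_odd
    (ι : PadicAlgCl p ≃+* ℂ) (hp2 : p ≠ 2) (hN : ¬ p ∣ N) (hχ : χ.IsPrimitive) (hk : 3 ≤ k)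
    (hkw : k = p ∨ k = p + 1 ∨ (3 ≤ k ∧ k + 1 ≤ p))
    (hM : M.Prime) (hMp : M ≠ p) (hMN : M.Coprime N)
    (hcong : Valued.v (ι.symm ((χ (M : ZMod N) : ℂ) * (M : ℂ) ^ (k : ℤ)) - 1) < 1)
    (hvs : (p - 1) ∣ k → N = 1 → M ^ (p - 1) % p ^ 2 = 1) (γ : SL(2, ℤ)) :
    ∃ c : ℂ, Tendsto ((⇑(eisensteinLevelRaised N k χ M hk) : ℍ → ℂ) ∣[(k : ℤ)] γ) atImInfty (𝓝 c) ∧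
      Valued.v (ι.symm c) < 1 := by
  have hp : p.Prime := Fact.out
  have hp3 : 3 ≤ p := by have := hp.two_le; omega
  -- the subring of `ι⁻¹`-integral complex numbers
  set S : Subring ℂ :=
    ((Valued.v (R := PadicAlgCl p)).valuationSubring.toSubring).comap ι.symm.toRingHom with hS
  have hmem : ∀ x : ℂ, x ∈ S ↔ Valued.v (ι.symm x) ≤ 1 := fun x ↦ by
    simp [hS, Valuation.mem_valuationSubring_iff]
  have hχS : ∀ j, χ j ∈ S := fun j ↦ (hmem _).2 (valuation_ringEquiv_symm_apply_le_one χ ι j)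
  have hratS : ∀ q : ℚ, Rat.padicValuation p q ≤ 1 → algebraMap ℚ ℂ q ∈ S := fun q hq ↦
    (hmem _).2 (valuation_ringEquiv_symm_ratCast_le_one ι hq)
  -- off the corners it suffices that `-(B_{k,χ}/4k)` be `p`-integral
  have hoff : -(generalizedBernoulli k χ) / (4 * k) ∈ S →
      ∃ c : ℂ, Tendsto ((⇑(eisensteinLevelRaised N k χ M hk) : ℍ → ℂ) ∣[(k : ℤ)] γ) atImInfty
        (𝓝 c) ∧ Valued.v (ι.symm c) < 1 := fun hB ↦ by
    refine exists_tendsto_eisensteinLevelRaised_slash_valuation_lt_one_of_lt k χ M ι hk hM hMp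
      hMN ?_ γ
    rw [map_mul, Valuation.map_mul]
    calc _ ≤ 1 * Valued.v (ι.symm (χ (M : ZMod N) * (M : ℂ) ^ (k : ℤ) - 1)) :=
          mul_le_mul' ((hmem _).1 hB) le_rfl
      _ < 1 := by rw [one_mul, map_sub, map_one]; exact hcong
  -- `p ∤ 4 m` for `p ∤ m`, and the division by `4k`
  have h4' : ¬ p ∣ 4 := fun h ↦ hp2 ((Nat.prime_dvd_prime_iff_eq hp Nat.prime_two).mp
    (hp.dvd_of_dvd_pow (show p ∣ 2 ^ 2 by simpa using h)))
  have h4 : ∀ {m : ℕ}, ¬ p ∣ m → ¬ p ∣ 4 * m := fun {m} hm h ↦ by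
    rcases (Nat.Prime.dvd_mul hp).1 h with h4 | h4
    · exact h4' h4
    · exact hm h4
  have hcast : ∀ m : ℕ, (4 * (m : ℂ)) = ((4 * m : ℕ) : ℂ) := fun m ↦ by push_cast; ring
  -- a primitive trivial character has level `1`
  have hN1 : χ = 1 → N = 1 := fun h ↦ by
    have h1 := hχ
    rw [DirichletCharacter.isPrimitive_def, h, DirichletCharacter.conductor_one] at h1
    exact h1.symm
  rcases hkw with hkp | hkp | ⟨-, hkp⟩
  · -- ### `k = p`: `B_{p,χ} ∈ p S`, so `-(B_{p,χ}/4p) = -s/4 ∈ S`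
    apply hoff
    rw [hkp]
    obtain ⟨s, hs, hBs⟩ := exists_generalizedBernoulli_prime_eq_mul hp2 χ S hχS hratS hN
    have hp0 : (p : ℂ) ≠ 0 := by exact_mod_cast hp.ne_zero
    have h1 : -(generalizedBernoulli p χ) / (4 * p) = -s / ((4 : ℕ) : ℂ) := by
      rw [hBs, map_natCast]
      field_simp
      push_cast
      ring
    rw [h1]
    exact neg_div_natCast_mem hratS hs h4'
  · -- ### `k = p + 1`
    rcases Nat.lt_or_ge p 5 with hp5 | hp5
    · -- `p = 3`, `k = 4`
      have hp3' : p = 3 := by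
        rcases (show p = 3 ∨ p = 4 by omega) with h | h
        · exact h
        · exact absurd (h ▸ hp) (by decide)
      have hk4 : k = 4 := by omega
      subst hk4
      by_cases hχ1 : χ = 1
      · -- the corner `χ = 𝟙`, `N = 1`: `M² ≡ 1 (mod 9)`
        have hN1' := hN1 hχ1
        subst hN1'
        have hM2 : M ^ 2 % 9 = 1 := by
          have h := hvs (by rw [hp3']; decide) rfl
          rwa [hp3'] at h
        refine exists_tendsto_eisensteinLevelRaised_slash_valuation_lt_one_of_lt 4 χ M ι hk hM
          hMp hMN ?_ γ
        obtain ⟨y, hy, hy'⟩ := exists_bernoulli_four_div_mul_pow_sub_one_eq_mul hp3' hM2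
        have hχ1v : χ (M : ZMod 1) = 1 := by
          rw [hχ1, MulChar.one_apply (isUnit_of_subsingleton _)]
        have hQ : -(generalizedBernoulli 4 χ) / (4 * ((4 : ℕ) : ℂ)) *
            (χ (M : ZMod 1) * (M : ℂ) ^ ((4 : ℕ) : ℤ) - 1) = (p : ℂ) * algebraMap ℚ ℂ y := by
          rw [hχ1v, one_mul, generalizedBernoulli_modOne, zpow_natCast, hp3']
          have h := congrArg (algebraMap ℚ ℂ) hy'
          simp only [map_mul, map_div₀, map_sub, map_pow, map_natCast, map_one, map_neg,
            map_ofNat] at h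
          push_cast at h ⊢
          linear_combination h
        rw [hQ, map_mul, map_natCast, Valuation.map_mul]
        calc Valued.v (p : PadicAlgCl p) * Valued.v (ι.symm (algebraMap ℚ ℂ y))
            ≤ Valued.v (p : PadicAlgCl p) * 1 :=
            mul_le_mul' le_rfl (valuation_ringEquiv_symm_ratCast_le_one ι hy)
          _ < 1 := by rw [mul_one]; exact valuation_natCast_padicAlgCl_self_lt_one
      · -- `χ ≠ 𝟙`: `B_{4,χ}` is `3`-integral
        apply hoff
        rw [hcast]
        exact neg_div_natCast_mem hratS
          (generalizedBernoulli_four_mem_subring_of_ne_one hp3' hχ1 S hχS hratS hN)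
          (by rw [hp3']; decide)
    · -- `p ≥ 5`
      apply hoff
      subst hkp
      rw [show ((p + 1 : ℕ) : ℂ) = (p + 1 : ℕ) from rfl, hcast]
      exact neg_div_natCast_mem hratS
        (generalizedBernoulli_prime_add_one_mem_subring hp5 χ S hχS hratS hN)
        (h4 fun h ↦ hp.one_lt.ne' (Nat.dvd_one.mp ((Nat.dvd_add_right (dvd_refl p)).mp h)))
  · -- ### `3 ≤ k ≤ p - 1`
    rcases Nat.lt_or_ge k (p - 1) with hlt | hge
    · -- `k < p - 1`: the window of B–M 2018
      apply hoff
      rw [hcast]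
      exact neg_div_natCast_mem hratS (generalizedBernoulli_mem_subring χ S hχS hratS hN hlt)
        (h4 fun h ↦ by have := Nat.le_of_dvd (by omega) h; omega)
    · have hkp1 : k = p - 1 := by omega
      by_cases hχ1 : χ = 1
      · -- the corner `(k, χ) = (p - 1, 𝟙)`, `N = 1`: `M^{p-1} ≡ 1 (mod p²)`
        have hN1' := hN1 hχ1
        subst hN1'
        have hM2 : M ^ (p - 1) % p ^ 2 = 1 := hvs (hkp1 ▸ dvd_rfl) rfl
        exact exists_tendsto_eisensteinLevelRaised_slash_valuation_lt_one_corner k M χ ι hp2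
          (by omega) hk hM hMp hM2 γ
      · apply hoff
        subst hkp1
        rw [hcast]
        exact neg_div_natCast_mem hratS
          (generalizedBernoulli_prime_sub_one_mem_subring hp2 hχ1 S hχS hratS hN)
          (h4 fun h ↦ by have := Nat.le_of_dvd (by omega) h; omega)

end Cusps

end Literature.NumberTheory.EllipticCurves.ModularForms
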